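import Summits.HodgeConjecture.CorCM.Census.CyclicCharacterBalancedTypeK

/-!
# Cyclic characters, XLV: THE RELATION OF THE OWNED BALANCED FACE for every `k` — `R(B) ∈ L` from the face, the interval rule and the unit shifts

COR-CM (cell `pub-hodgecm2`), count-neutral kernel combinatorics by the binder seat b09 (gen 44; lane CYCLIC-CHARACTER FIBRE LAW, part XLV — the `k ≥ 3`
version of part XXXVIII, cf. `HOME/pub-hodgecm2-b09/lean-g44/LOWER-RULE-ROADMAP.md`), on parts XXXVIII (`k = 2` template and small lemmas), XLIII, XLIV
BY NAME.  Theorems only (no definition, no `decide`, no certificate, no named fact, no `sorry`).  HONEST FRAMING: `HC_CM` is NOT proved, here or anywhere in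
the tree; nothing here is a period or a headline.

**THEOREM (`rel_of_balancedFaceK`, `k ≥ 2`, `n = 2m`).**  Let `L = ℤ⟨pairs⟩ + ℤ[G]·S` have the toward property and obey the INTERVAL RULE outside a block `E`
that avoids the bottom-edge sub-types of `Ψ`; let `Ψ·g⁻¹ = Ψ` with `w g = 1`; let `L` contain the owned face `gface Ψ s t'` (`s ∈ F_0 ∩ Ψ`, `t' ∈ F_{h−1} ∖ Ψ`)
and the UNIT SHIFTS `([T_0^{(q)}] − [T_0]) − ([T_1^{(q)}] − [T_1])` of all `q ∈ T_0` with `w q ≠ 0`.  Then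
`R(B) = [T_0] − [T_1] + Σ_{q ∈ B} ([T_0^{(q)}] − [T_0]) − Σ_{q ∈ F_0 ∖ B} ([T_1^{(q)}] − [T_1]) ∈ L`, `B = F_0 ∖ Ψ` — the input `h3` of part XIXʼs
`fib_mem_of_rel`.  PROOF as in part XXXVIII: `[Ψ] ≡ Ξ := (ε_0(b'))·g + NF_0(Ψ^{(t')})`, `Ξ − Ξ·g ∈ L`; now `(ε_0(b'))·g² = [T_2^{(t'g)}] − [T_2]` is converted
to `[T_1^{(s_{t'})}] − [T_1]` by the unit shift of `t'` translated by `g`, and `NF_0(Ψ^{(t')})·g` is rewritten by the reindexings `(D∖F_{h−1})·g = D∖F_0`,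
`c·((F_{h−1}∖Ψ)∖t')·g = (F_0 ∩ Ψ) ∖ s_{t'}`; the middle and top positions contribute unit shifts.  For `k = 2` this is part XXXVIIIʼs relation with the pair
term replaced by the (then pair-valued) translated unit shift.

## References
* [Pohlmann1968] H. Pohlmann, Algebraic cycles on abelian varieties of complex multiplication type, Ann. of Math. 88 (1968), Thm 1.
-/

namespace Summit.HodgeConjecture.CorCM.Census.CyclicCharacter

open Finset
open Summit.HodgeConjecture.CorCM.Prior.AllgGroup.RfwfAllgGroup
open Summit.HodgeConjecture.CorCM.Census.BlockParity
open Summit.HodgeConjecture.CorCM.Census.Coinvariant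
open Summit.HodgeConjecture.CorCM.Census.TwistGeneration
open Summit.HodgeConjecture.CorCM.Census.BaseBlock

noncomputable section

variable {G : Type*} [Group G] [Fintype G] [DecidableEq G] {k : ℕ} {w : G → ZMod (2 ^ k)} {c : G}

/-- For `w g = 1`: `T_1·g = T_2`. [folklore] -/
theorem rt_inv_arcType_one (hw : ∀ P Q : G, w (P * Q) = w P + w Q) (hk : 1 ≤ k) (hc2 : c * c = 1) (hwc : w c ≠ 0) {g : G} (hg : w g = 1) :
    rt c g⁻¹ (arcType hw hk hc2 hwc 1) = arcType hw hk hc2 hwc 2 := by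
  rw [rt_arcType, map_inv hw, hg]; norm_num

/-- **THE RELATION OF THE OWNED BALANCED FACE for every `k`** (see the file header). [folklore] -/
theorem rel_of_balancedFaceK (hw : ∀ P Q : G, w (P * Q) = w P + w Q) (hk : 1 ≤ k) (hk2 : 2 ≤ k) (hc2 : c * c = 1)
    (hcen : ∀ x : G, x * c = c * x) (hwc : w c ≠ 0) (h1 : ∃ g₁ : G, w g₁ = 1) {m : ℕ} (hm : 2 * m = (univ.filter fun s : G => w s = 0).card)
    (S : Finset (CMF G c →₀ ℤ))
    (htw : ∀ Φ : CMF G c, 2 ≤ bpot c (arcType hw hk hc2 hwc 0) Φ → ∃ Q t t' : G,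
      bpot c (arcType hw hk hc2 hwc 0) Φ = ddist (rt c Q (arcType hw hk hc2 hwc 0)) Φ ∧
        t ∈ (rt c Q (arcType hw hk hc2 hwc 0)).1 \ Φ.1 ∧ t' ∈ (rt c Q (arcType hw hk hc2 hwc 0)).1 \ Φ.1 ∧ t ≠ t' ∧
          gface c hc2 Φ t t' ∈ Submodule.span ℤ (pairSet c) ⊔ Submodule.span ℤ (translates c S))
    (E : Block c)
    (hrule : ∀ (Z : CMF G c) (Q : G) (r : ℕ), blk c Z ≠ E → 2 ≤ bpot c (arcType hw hk hc2 hwc 0) Z → r + 1 < 2 ^ k →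
      (∀ P : G, bpot c (arcType hw hk hc2 hwc 0) Z = ddist (rt c P (arcType hw hk hc2 hwc 0)) Z ↔ ∃ i : ℕ, i ≤ r ∧ w P = w Q - (i : ZMod (2 ^ k))) →
      ∃ s s' : G, s ∈ (rt c Q (arcType hw hk hc2 hwc 0)).1 \ Z.1 ∧ s' ∈ (rt c Q (arcType hw hk hc2 hwc 0)).1 \ Z.1 ∧ s ≠ s' ∧
        gface c hc2 Z s s' ∈ Submodule.span ℤ (pairSet c) ⊔ Submodule.span ℤ (translates c S))
    {Ψ : CMF G c} {g : G} (hΨ : rt c g Ψ = Ψ) (hg : w g = 1)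
    (hE : ∀ Z : CMF G c, (arcType hw hk hc2 hwc 0).1 \ Z.1 ⊆ (arcType hw hk hc2 hwc 0).1 \ Ψ.1 →
      ((univ.filter fun s : G => w s = 0) \ Z.1).card = m → blk c Z ≠ E)
    {s t' : G} (hs0 : w s = 0) (hsΨ : s ∈ Ψ.1) (ht'1 : w t' = ((2 ^ (k - 1) - 1 : ℕ) : ZMod (2 ^ k))) (ht'Ψ : t' ∉ Ψ.1)
    (hface : gface c hc2 Ψ s t' ∈ Submodule.span ℤ (pairSet c) ⊔ Submodule.span ℤ (translates c S))
    (hunit : ∀ q : G, q ∈ (arcType hw hk hc2 hwc 0).1 → w q ≠ 0 →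
      (Finsupp.single (oflipCM c hc2 q (arcType hw hk hc2 hwc 0)) (1 : ℤ) - Finsupp.single (arcType hw hk hc2 hwc 0) 1) -
          (Finsupp.single (oflipCM c hc2 q (arcType hw hk hc2 hwc 1)) (1 : ℤ) - Finsupp.single (arcType hw hk hc2 hwc 1) 1) ∈
        Submodule.span ℤ (pairSet c) ⊔ Submodule.span ℤ (translates c S)) :
    Finsupp.single (arcType hw hk hc2 hwc 0) (1 : ℤ) - Finsupp.single (arcType hw hk hc2 hwc 1) 1 +
        (∑ q ∈ (univ.filter fun s : G => w s = 0) \ Ψ.1,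
          (Finsupp.single (oflipCM c hc2 q (arcType hw hk hc2 hwc 0)) (1 : ℤ) - Finsupp.single (arcType hw hk hc2 hwc 0) 1)) -
        (∑ q ∈ (univ.filter fun s : G => w s = 0) \ ((univ.filter fun s : G => w s = 0) \ Ψ.1),
          (Finsupp.single (oflipCM c hc2 q (arcType hw hk hc2 hwc 1)) (1 : ℤ) - Finsupp.single (arcType hw hk hc2 hwc 1) 1)) ∈
      Submodule.span ℤ (pairSet c) ⊔ Submodule.span ℤ (translates c S) := by
  haveI : Fact (1 < 2 ^ k) := ⟨Nat.one_lt_two_pow (by omega)⟩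
  have hh2 : 2 ≤ 2 ^ (k - 1) := le_trans (pow_one 2).symm.le (Nat.pow_le_pow_right (by norm_num) (by omega))
  set L := Submodule.span ℤ (pairSet c) ⊔ Submodule.span ℤ (translates c S) with hL
  have hLG : ∀ (Q : G) (y : CMF G c →₀ ℤ), y ∈ L → Finsupp.mapDomain (rt c Q) y ∈ L := fun Q y hy => mapDomain_rt_mem_psp c hcen Q S hy
  -- the elements and numerals
  have hTone : rt c g⁻¹ (arcType hw hk hc2 hwc 0) = arcType hw hk hc2 hwc 1 := rt_inv_arcType_zero hw hk hc2 hwc hg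
  have hT12 : rt c g⁻¹ (arcType hw hk hc2 hwc 1) = arcType hw hk hc2 hwc 2 := rt_inv_arcType_one hw hk hc2 hwc hg
  have ht'1' : w t' = ((2 ^ (k - 1) : ℕ) : ZMod (2 ^ k)) - 1 := by rw [ht'1, natCast_half_sub_one]
  have ht'0 : w t' ≠ 0 := fun h => by
    rw [ht'1, ← Nat.cast_zero] at h
    have := natCast_inj_of_lt_half hk (by omega) (by omega) h
    omega
  obtain ⟨hb', hb'Ψ⟩ := bprimeK_spec hw hΨ hg ht'Ψ
  obtain ⟨hst0, hstΨ⟩ := stK_spec hw hk hc2 hwc hΨ hg ht'1' ht'Ψ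
  have hb'g : t' * g⁻¹ * g = t' := inv_mul_cancel_right t' g
  obtain ⟨ht'D, hdev1⟩ := cornerK_one_dev hw hk hc2 hwc Ψ ht'1 ht'Ψ
  obtain ⟨hrt2, hvs1, hvsD, hdev2⟩ := cornerK_two_spec hw hk hc2 hwc hΨ hg hs0 hsΨ
  obtain ⟨hrt3, hb'mem, -, hdev3⟩ := cornerK_three_spec hw hk hk2 hc2 hwc hΨ hg hs0 hsΨ ht'1 ht'Ψ
  have ht'T : t' ∈ (arcType hw hk hc2 hwc 0).1 := (mem_sdiff.mp ht'D).1
  have hstB : c * (t' * g) ∉ (univ.filter fun s : G => w s = 0) \ Ψ.1 := fun h => (mem_sdiff.mp h).2 hstΨ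
  have hstF : c * (t' * g) ∈ (univ.filter fun s : G => w s = 0) \ ((univ.filter fun s : G => w s = 0) \ Ψ.1) :=
    mem_sdiff.mpr ⟨mem_filter.mpr ⟨mem_univ _, hst0⟩, hstB⟩
  -- the two splits of the deviation `D = T_0 ∖ Ψ`
  have hB : (univ.filter fun s : G => w s = 0) \ Ψ.1 = ((arcType hw hk hc2 hwc 0).1 \ Ψ.1).filter fun q => w q = 0 := by
    have h := fib_sdiff_eq_filter_of_lt hw hk hc2 hwc Ψ (j := 0) (by omega)
    rw [Nat.cast_zero] at h; exact h
  have hTop : (univ.filter fun s : G => w s = ((2 ^ (k - 1) - 1 : ℕ) : ZMod (2 ^ k))) \ Ψ.1 =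
      ((arcType hw hk hc2 hwc 0).1 \ Ψ.1).filter fun q => w q = ((2 ^ (k - 1) - 1 : ℕ) : ZMod (2 ^ k)) :=
    fib_sdiff_eq_filter_of_lt hw hk hc2 hwc Ψ (by omega)
  have hsplitA : ((arcType hw hk hc2 hwc 0).1 \ Ψ.1).erase t' =
      (((arcType hw hk hc2 hwc 0).1 \ Ψ.1).filter fun q => w q = 0) ∪ (((arcType hw hk hc2 hwc 0).1 \ Ψ.1).filter fun q => ¬ w q = 0).erase t' := by
    rw [← erase_eq_of_notMem (s := ((arcType hw hk hc2 hwc 0).1 \ Ψ.1).filter fun q => w q = 0) (a := t')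
      (by rw [mem_filter]; exact fun h => ht'0 h.2), ← erase_union_distrib, filter_union_filter_not_eq]
  have hdisjA : Disjoint (((arcType hw hk hc2 hwc 0).1 \ Ψ.1).filter fun q => w q = 0)
      ((((arcType hw hk hc2 hwc 0).1 \ Ψ.1).filter fun q => ¬ w q = 0).erase t') :=
    (disjoint_filter_filter_not _ _ _).mono_right (erase_subset _ _)
  have hsplitB : ((arcType hw hk hc2 hwc 0).1 \ Ψ.1).erase t' =
      (((arcType hw hk hc2 hwc 0).1 \ Ψ.1).filter fun q => ¬ w q = ((2 ^ (k - 1) - 1 : ℕ) : ZMod (2 ^ k))) ∪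
        (((arcType hw hk hc2 hwc 0).1 \ Ψ.1).filter fun q => w q = ((2 ^ (k - 1) - 1 : ℕ) : ZMod (2 ^ k))).erase t' := by
    rw [← erase_eq_of_notMem (s := ((arcType hw hk hc2 hwc 0).1 \ Ψ.1).filter fun q => ¬ w q = ((2 ^ (k - 1) - 1 : ℕ) : ZMod (2 ^ k))) (a := t')
      (by rw [mem_filter]; exact fun h => h.2 ht'1), ← erase_union_distrib, union_comm, filter_union_filter_not_eq]
  have hdisjB : Disjoint (((arcType hw hk hc2 hwc 0).1 \ Ψ.1).filter fun q => ¬ w q = ((2 ^ (k - 1) - 1 : ℕ) : ZMod (2 ^ k)))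
      ((((arcType hw hk hc2 hwc 0).1 \ Ψ.1).filter fun q => w q = ((2 ^ (k - 1) - 1 : ℕ) : ZMod (2 ^ k))).erase t') :=
    (disjoint_filter_filter_not _ _ _).symm.mono_right (erase_subset _ _)
  have ht'nz : t' ∈ ((arcType hw hk hc2 hwc 0).1 \ Ψ.1).filter fun q => ¬ w q = 0 := mem_filter.mpr ⟨ht'D, ht'0⟩
  -- the canonical linearisations of the three corners
  have hsub1 : (arcType hw hk hc2 hwc 0).1 \ (oflipCM c hc2 t' Ψ).1 ⊆ (arcType hw hk hc2 hwc 0).1 \ Ψ.1 := by rw [hdev1]; exact erase_subset _ _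
  have hsub2 : (arcType hw hk hc2 hwc 0).1 \ (oflipCM c hc2 (c * (s * g⁻¹)) Ψ).1 ⊆ (arcType hw hk hc2 hwc 0).1 \ Ψ.1 := by rw [hdev2]; exact erase_subset _ _
  have hsub3 : (arcType hw hk hc2 hwc 0).1 \ (oflipCM c hc2 (c * (s * g⁻¹)) (oflipCM c hc2 (t' * g⁻¹) Ψ)).1 ⊆
      ((arcType hw hk hc2 hwc 0).1 \ Ψ.1).erase (c * (s * g⁻¹)) := by rw [hdev3, erase_right_comm]; exact erase_subset _ _
  have e1 := single_sub_normalForm_mem_of_subBalanced hw hk hc2 hwc h1 L htw hm E hrule (oflipCM c hc2 t' Ψ)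
    (card_fib_sdiff_le_of_sub hw hk hc2 hwc h1 hm hΨ hg hsub1)
    (card_top_sdiff_lt_of_sub_erase hw hk hc2 hwc h1 hm hΨ hg ht'1 ht'D (by rw [hdev1]))
    (fun Z hZ hZm => hE Z (hZ.trans hsub1) hZm)
  have e2 := single_sub_thetaG_rt_mem_of_subBalanced hw hk hc2 hwc h1 L hLG htw hm E hrule (oflipCM c hc2 (c * (s * g⁻¹)) Ψ)
    (card_fib_sdiff_le_of_sub hw hk hc2 hwc h1 hm hΨ hg hsub2)
    (card_top_sdiff_lt_of_sub_erase hw hk hc2 hwc h1 hm hΨ hg hvs1 hvsD (by rw [hdev2]))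
    (fun Z hZ hZm => hE Z (hZ.trans hsub2) hZm) g⁻¹
  have e3 := single_sub_thetaG_rt_mem_of_subBalanced hw hk hc2 hwc h1 L hLG htw hm E hrule (oflipCM c hc2 (c * (s * g⁻¹)) (oflipCM c hc2 (t' * g⁻¹) Ψ))
    (card_fib_sdiff_le_of_sub hw hk hc2 hwc h1 hm hΨ hg (hsub3.trans (erase_subset _ _)))
    (card_top_sdiff_lt_of_sub_erase hw hk hc2 hwc h1 hm hΨ hg hvs1 hvsD hsub3)
    (fun Z hZ hZm => hE Z (hZ.trans (hsub3.trans (erase_subset _ _))) hZm) g⁻¹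
  rw [← mapDomain_rt_thetaG, thetaG_typeSum_single, hdev2, hrt2] at e2
  rw [← mapDomain_rt_thetaG, thetaG_typeSum_single, hdev3, hrt3] at e3
  rw [hdev1] at e1
  -- `NF_0(Y₂) − NF_0(Y₃) = ε_0(b')`
  have hNF23 : ((∑ t ∈ ((arcType hw hk hc2 hwc 0).1 \ Ψ.1).erase (c * (s * g⁻¹)), (Finsupp.single (oflipCM c hc2 t (arcType hw hk hc2 hwc 0)) (1 : ℤ) -
        Finsupp.single (arcType hw hk hc2 hwc 0) 1)) + Finsupp.single (arcType hw hk hc2 hwc 0) 1) -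
      ((∑ t ∈ (((arcType hw hk hc2 hwc 0).1 \ Ψ.1).erase (t' * g⁻¹)).erase (c * (s * g⁻¹)), (Finsupp.single (oflipCM c hc2 t (arcType hw hk hc2 hwc 0)) (1 : ℤ) -
        Finsupp.single (arcType hw hk hc2 hwc 0) 1)) + Finsupp.single (arcType hw hk hc2 hwc 0) 1) =
      Finsupp.single (oflipCM c hc2 (t' * g⁻¹) (arcType hw hk hc2 hwc 0)) (1 : ℤ) - Finsupp.single (arcType hw hk hc2 hwc 0) 1 := by
    rw [erase_right_comm, ← add_sum_erase _ _ hb'mem]; abel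
  -- `[Ψ] − (ε_0(b')·g + NF_0(X₁)) ∈ L`
  have hD1 : Finsupp.single Ψ (1 : ℤ) - Finsupp.mapDomain (rt c g⁻¹) (Finsupp.single (oflipCM c hc2 (t' * g⁻¹) (arcType hw hk hc2 hwc 0)) (1 : ℤ) -
        Finsupp.single (arcType hw hk hc2 hwc 0) 1) -
      ((∑ t ∈ ((arcType hw hk hc2 hwc 0).1 \ Ψ.1).erase t', (Finsupp.single (oflipCM c hc2 t (arcType hw hk hc2 hwc 0)) (1 : ℤ) -
        Finsupp.single (arcType hw hk hc2 hwc 0) 1)) + Finsupp.single (arcType hw hk hc2 hwc 0) 1) ∈ L := by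
    have h := Submodule.add_mem _ (Submodule.add_mem _ (Submodule.sub_mem _ hface e3) e2) e1
    rw [← hNF23, Finsupp.mapDomain_sub]
    convert h using 1
    simp only [gface]
    abel
  have hD1' := hLG g⁻¹ _ hD1
  rw [Finsupp.mapDomain_sub, Finsupp.mapDomain_sub, Finsupp.mapDomain_single, rt_inv_eq_self_of_rt_eq hΨ] at hD1'
  have hρ := Submodule.sub_mem _ hD1' hD1
  -- piece 1: `ε_0(b')·g = η(t')`
  have p1 : Finsupp.mapDomain (rt c g⁻¹) (Finsupp.single (oflipCM c hc2 (t' * g⁻¹) (arcType hw hk hc2 hwc 0)) (1 : ℤ) - Finsupp.single (arcType hw hk hc2 hwc 0) 1) =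
      Finsupp.single (oflipCM c hc2 t' (arcType hw hk hc2 hwc 1)) (1 : ℤ) - Finsupp.single (arcType hw hk hc2 hwc 1) 1 := by
    rw [Finsupp.mapDomain_sub, Finsupp.mapDomain_single, Finsupp.mapDomain_single, rt_oflipCM, inv_inv, hb'g, hTone]
  -- piece 2: `ε_0(b')·g² = [T_2^{(t'g)}] − [T_2] = η(s_{t'}) − (unit shift of t')·g`
  have p2 : Finsupp.mapDomain (rt c g⁻¹) (Finsupp.mapDomain (rt c g⁻¹)
      (Finsupp.single (oflipCM c hc2 (t' * g⁻¹) (arcType hw hk hc2 hwc 0)) (1 : ℤ) - Finsupp.single (arcType hw hk hc2 hwc 0) 1)) =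
      (Finsupp.single (oflipCM c hc2 (c * (t' * g)) (arcType hw hk hc2 hwc 1)) (1 : ℤ) - Finsupp.single (arcType hw hk hc2 hwc 1) 1) -
        Finsupp.mapDomain (rt c g⁻¹) ((Finsupp.single (oflipCM c hc2 t' (arcType hw hk hc2 hwc 0)) (1 : ℤ) - Finsupp.single (arcType hw hk hc2 hwc 0) 1) -
          (Finsupp.single (oflipCM c hc2 t' (arcType hw hk hc2 hwc 1)) (1 : ℤ) - Finsupp.single (arcType hw hk hc2 hwc 1) 1)) := by
    rw [p1]
    simp only [Finsupp.mapDomain_sub, Finsupp.mapDomain_single, rt_oflipCM, inv_inv, hTone, hT12, oflipCM_cmul]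
    abel
  -- piece 3: `NF_0(X₁)·g`
  have hsumLo : (∑ q ∈ ((arcType hw hk hc2 hwc 0).1 \ Ψ.1).filter (fun q => ¬ w q = ((2 ^ (k - 1) - 1 : ℕ) : ZMod (2 ^ k))),
      (Finsupp.single (oflipCM c hc2 (q * g) (arcType hw hk hc2 hwc 1)) (1 : ℤ) - Finsupp.single (arcType hw hk hc2 hwc 1) 1)) =
      ∑ q ∈ ((arcType hw hk hc2 hwc 0).1 \ Ψ.1).filter (fun q => ¬ w q = 0),
        (Finsupp.single (oflipCM c hc2 q (arcType hw hk hc2 hwc 1)) (1 : ℤ) - Finsupp.single (arcType hw hk hc2 hwc 1) 1) := by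
    rw [← image_lo_mul_eq hw hk hc2 hwc hΨ hg, sum_image fun x _ y _ h => mul_right_cancel h]
  have hsumTop : (∑ q ∈ (((arcType hw hk hc2 hwc 0).1 \ Ψ.1).filter (fun q => w q = ((2 ^ (k - 1) - 1 : ℕ) : ZMod (2 ^ k)))).erase t',
      (Finsupp.single (oflipCM c hc2 (q * g) (arcType hw hk hc2 hwc 1)) (1 : ℤ) - Finsupp.single (arcType hw hk hc2 hwc 1) 1)) =
      ∑ q ∈ (univ.filter fun s : G => w s = 0) \ insert (c * (t' * g)) ((univ.filter fun s : G => w s = 0) \ Ψ.1),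
        (Finsupp.single (oflipCM c hc2 q (arcType hw hk hc2 hwc 1)) (1 : ℤ) - Finsupp.single (arcType hw hk hc2 hwc 1) 1) := by
    rw [← hTop, ← image_top_erase_eq_gen hw hk hc2 hwc hΨ hg t', sum_image fun x _ y _ h => mul_right_cancel (mul_left_cancel h)]
    exact sum_congr rfl fun q _ => by rw [oflipCM_cmul]
  have p3 : Finsupp.mapDomain (rt c g⁻¹) ((∑ t ∈ ((arcType hw hk hc2 hwc 0).1 \ Ψ.1).erase t',
      (Finsupp.single (oflipCM c hc2 t (arcType hw hk hc2 hwc 0)) (1 : ℤ) - Finsupp.single (arcType hw hk hc2 hwc 0) 1)) + Finsupp.single (arcType hw hk hc2 hwc 0) 1) =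
      (∑ q ∈ ((arcType hw hk hc2 hwc 0).1 \ Ψ.1).filter (fun q => ¬ w q = 0),
        (Finsupp.single (oflipCM c hc2 q (arcType hw hk hc2 hwc 1)) (1 : ℤ) - Finsupp.single (arcType hw hk hc2 hwc 1) 1)) +
      (∑ q ∈ (univ.filter fun s : G => w s = 0) \ insert (c * (t' * g)) ((univ.filter fun s : G => w s = 0) \ Ψ.1),
        (Finsupp.single (oflipCM c hc2 q (arcType hw hk hc2 hwc 1)) (1 : ℤ) - Finsupp.single (arcType hw hk hc2 hwc 1) 1)) +
        Finsupp.single (arcType hw hk hc2 hwc 1) 1 := by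
    rw [Finsupp.mapDomain_add, Finsupp.mapDomain_finsetSum, Finsupp.mapDomain_single, hTone]
    simp only [Finsupp.mapDomain_sub, Finsupp.mapDomain_single, rt_oflipCM, inv_inv, hTone]
    rw [hsplitB, sum_union hdisjB, hsumLo, hsumTop]
  -- piece 4: `NF_0(X₁)` split by the bottom fibre
  have p4 : ((∑ t ∈ ((arcType hw hk hc2 hwc 0).1 \ Ψ.1).erase t', (Finsupp.single (oflipCM c hc2 t (arcType hw hk hc2 hwc 0)) (1 : ℤ) -
      Finsupp.single (arcType hw hk hc2 hwc 0) 1)) + Finsupp.single (arcType hw hk hc2 hwc 0) 1) =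
      (∑ q ∈ (univ.filter fun s : G => w s = 0) \ Ψ.1, (Finsupp.single (oflipCM c hc2 q (arcType hw hk hc2 hwc 0)) (1 : ℤ) - Finsupp.single (arcType hw hk hc2 hwc 0) 1)) +
        (∑ q ∈ (((arcType hw hk hc2 hwc 0).1 \ Ψ.1).filter fun q => ¬ w q = 0).erase t',
          (Finsupp.single (oflipCM c hc2 q (arcType hw hk hc2 hwc 0)) (1 : ℤ) - Finsupp.single (arcType hw hk hc2 hwc 0) 1)) +
        Finsupp.single (arcType hw hk hc2 hwc 0) 1 := by
    rw [hsplitA, sum_union hdisjA, hB]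
  -- the unit shifts of the middle and top deviation points other than `t'`, and the translated unit shift of `t'`
  have hU : (∑ q ∈ (((arcType hw hk hc2 hwc 0).1 \ Ψ.1).filter fun q => ¬ w q = 0).erase t',
      ((Finsupp.single (oflipCM c hc2 q (arcType hw hk hc2 hwc 0)) (1 : ℤ) - Finsupp.single (arcType hw hk hc2 hwc 0) 1) -
        (Finsupp.single (oflipCM c hc2 q (arcType hw hk hc2 hwc 1)) (1 : ℤ) - Finsupp.single (arcType hw hk hc2 hwc 1) 1))) ∈ L :=
    Submodule.sum_mem _ fun q hq => by
      have hq' := mem_filter.mp (mem_of_mem_erase hq)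
      exact hunit q (mem_sdiff.mp hq'.1).1 hq'.2
  have hUt : Finsupp.mapDomain (rt c g⁻¹) ((Finsupp.single (oflipCM c hc2 t' (arcType hw hk hc2 hwc 0)) (1 : ℤ) - Finsupp.single (arcType hw hk hc2 hwc 0) 1) -
      (Finsupp.single (oflipCM c hc2 t' (arcType hw hk hc2 hwc 1)) (1 : ℤ) - Finsupp.single (arcType hw hk hc2 hwc 1) 1)) ∈ L :=
    hLG g⁻¹ _ (hunit t' ht'T ht'0)
  -- assemble
  have hres := Submodule.sub_mem _ (Submodule.sub_mem _ hρ hU) hUt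
  rw [p2, p1, p3, p4, ← add_sum_erase _ _ ht'nz, sdiff_insert] at hres
  rw [← add_sum_erase _ _ hstF]
  simp only [sum_sub_distrib] at hres ⊢
  convert hres using 1
  abel

end

end Summit.HodgeConjecture.CorCM.Census.CyclicCharacter
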